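import Literature.NumberTheory.EllipticCurves.ZpExtensionEisensteinH1Data
import Literature.NumberTheory.GaloisRepresentations.BlochKatoSelmerGroup
import Literature.NumberTheory.GaloisRepresentations.GaloisCohomologyScalarAction
import HarnessLib

/-!
# Howard's Selmer structure `F_𝔮` on `T_𝔮 = T_p E ⊗ Λ/(T^m + p)(ψ)`, level by level, and the pinned
# Selmer module `H¹_{F_𝔮}(K, T_𝔮) ⊆ H¹(K, T_𝔮)` (definitions with bodies + unfolding lemmas; no named fact,
# no instance, no notation)

Topic `NumberTheory/EllipticCurves` (D1 road of cell `pub/bsd-print-x9`; companion of `ZpExtensionScalarTwist`,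
`ZpExtensionScalarTwistMaps`, `ZpExtensionEisensteinH1Data`, `ZpExtensionEisensteinTwistCores`).

Howard [Howard 2004, Def. 2.1.1 (arXiv 1202.6340 Def. 2.1.1: local conditions and their PROPAGATION to sub-
and quotient modules), Def. 3.1.2 / §3.1 (the Selmer structure `F_𝔮` on `V_𝔮`: `H¹_ord(K_v, V_𝔮) =
im (H¹(K_v, Fil_v V_𝔮) → H¹(K_v, V_𝔮))` at `v ∣ p`, `H¹_unr` else, «propagated to `T_𝔮` and to `A_𝔮`»),
Def. 3.2.5 (`Fil_v T` = kernel of reduction, `gr_v = ·/Fil_v`), Lemma 3.2.7 / Prop. 3.2.8 (control at `𝔮`)]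
works with the compact `S_𝔮`-module `T_𝔮` and its continuous cohomology. In the tree `T_𝔮` at the Eisenstein
prime `𝔮 = (T^m + p)` is the inverse system of finite discrete Galois modules
`W_k = κ.eisensteinTwist (ρ k) hm k` on `M_k ⊗ A_{m,k}(ψ)` (`A_{m,k} = Λ/(q_m, p^k)`; intended `M_k = E[p^k]`)
with transitions `κ.eisensteinTwistReduce hm _ (t k)`, and `H¹(K, T_𝔮)` is PINNED as
`ZpExtension.EisensteinH1Data` (compatible families of classes). A Selmer structure on `T_𝔮` in this
currency is a family, indexed by the level `k`, of tree `SelmerStructure`s on the `W_k` (this is the shape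
`EisensteinH1Data.selmerAddSubgroup` consumes); this file DEFINES Howard's `F_𝔮` in that shape, with no
`V_𝔮 = T_𝔮 ⊗ ℚ_p` in sight, through the following dictionary (valid for any finitely generated `ℤ_p`-module
of coefficients, recorded in the docstrings, not asserted):

* **propagation from `V_𝔮` to `T_𝔮` = saturation.** For a local condition `C ⊆ H¹(K_v, V_𝔮)` cut out as
  the kernel of a map `r : H¹(K_v, ·) → H¹(·)` functorial in the coefficients (`r = gr_v` at `v ∣ p`:
  `H¹_ord = ker (H¹(K_v, V_𝔮) → H¹(K_v, gr_v V_𝔮))` by exactness; `r = res` to `K_v^{ur}` at `v ∤ p`), the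
  preimage in `H¹(K_v, T_𝔮)` is `{x | r x ∈ H¹(·, T-coefficients)[p^∞]}` (the kernel of
  `H¹(·, T') → H¹(·, T' ⊗ ℚ_p)` is the torsion), i.e. `{x | ∃ a, p^a • r x = 0} = {x | ∃ a, p^a x ∈ ker r}`.
* **`H¹(K_v, T_𝔮) = lim_k H¹(K_v, W_k)`** (finite coefficient modules over a local field; Tate / Serre II §1),
  so `x = (x_j)_j` is a reduction-compatible family of local classes and `p^a x ∈ ker r` reads
  `∀ j, p^a • x_j ∈ C_j` with `C_j = ker r_j ⊆ H¹(K_v, W_j)` the level-`j` CORE condition.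
* **propagation from `T_𝔮` to the quotient `T_𝔮/p^k = W_k` = image** under `x ↦ x_k`.

Whence the content of this file:

* §1 (pure algebra) for a tower of abelian groups `(H j, red j : H (j+1) → H j)`, a number `p` and level-wise
  cores `C j ≤ H j`: `Tower.compatibleFamilies red`, **`Tower.saturatedFamilies red p C`**
  `= {x compatible | ∃ a, ∀ j, p^a • x j ∈ C j}` and the **level condition**
  `Tower.levelCondition red p C k = {x k | x ∈ saturatedFamilies}` with their membership lemmas,
  monotonicity in `C`, and `mem_levelCondition_of_forall_mem` (a compatible family lying in the cores at
  every level lies in the level condition at every level).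
* §2 the restriction `DiscreteGaloisModule.localMap f v` of an equivariant map to a place and the naturality
  `localization v ∘ H¹(f) = H¹(localMap f v) ∘ localization v` (`galoisCohomology.localization_map_one`); the
  local towers `ZpExtension.eisensteinLocalReduce κ ρ t hm v k : H¹(K_v, W_{k+1}) → H¹(K_v, W_k)`.
* §3 `ZpExtension.OrdinaryFiltration κ ρ t v` — the ordinary datum at a place `v ∣ p`: `Γ_{K_v}`-stable
  `ℤ`-submodules `fil k ≤ M_k` compatible with the transitions (intended `Fil_v E[p^k] = Ê[p^k]`, the kernel of
  reduction at `v` for `E` with good ordinary reduction; Howard Def. 3.2.5); the twisted plus part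
  `twistedFil = A_{m,k} ⊗ Fil_v M_k ≤ W_k` (stable under the twisted LOCAL action, `twistedFil_le_comap`) and the
  level-`k` core at `v ∣ p`, the tree's STRICT condition `ker (H¹(K_v, W_k) → H¹(K_v, W_k / W_k⁺)) =
  im (H¹(K_v, W_k⁺) → H¹(K_v, W_k))` (`DiscreteGaloisModule.strictSubgroup`), `ordinaryCore`.
* §4 **`ZpExtension.eisensteinSelmerStructure κ ρ t hm S Φ k : SelmerStructure (κ.eisensteinTwist (ρ k) hm k)`**
  — Howard's `F_𝔮` at level `k`, for a finite set `S` of finite places (intended: the primes of bad reduction)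
  and ordinary data `Φ v` at the places `v ∣ p`: no condition at the infinite places; at `v ∣ p` the level
  condition of the saturated ORDINARY tower; at `v ∈ S`, `v ∤ p` the level condition of the saturated
  UNRAMIFIED tower (cores `DiscreteGaloisModule.unramifiedSubgroup`); at every other finite place the unramified
  condition itself (there `T_𝔮` is unramified, `H¹(K_v^{ur}, T_𝔮)` is torsion-free and `H¹_ur` is right exact
  in the coefficients, so Howard's propagated condition IS the unramified one; we define it as such, so that the
  structure is unramified outside `∞ ∪ S ∪ {v ∣ p}` BY CONSTRUCTION, as `Howard2004.IsHowardSelmerStructure` and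
  `SelmerStructure.IsUnramifiedOutside` require). Unfolding lemmas per case.
* §5 **`EisensteinH1Data.ordinarySelmer D S Φ ≤ D.H`** — Howard's `H¹_{F_𝔮}(K, T_𝔮) = lim_k H¹_{F_𝔮}(K, T_𝔮/p^k)`
  inside the pinned `H¹(K, T_𝔮)`: `D.selmerAddSubgroup (eisensteinSelmerStructure …)` (the carrier `H` of a
  `SpecWitness` of `Summits/…/PrintX9MuPartSpecWitnessDefs` on the D1 road).

DEFINITIONS WITH BODIES and unfolding lemmas only; nothing is asserted about any curve, Selmer group or
`L`-function; no instance, no notation, no `sorry`. NOT here (next files): the stability of `F_𝔮` under the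
coefficient action (so that `ordinarySelmer` is a `Λ`-submodule, `EisensteinH1Data.selmerSubmodule`), the proof
that `eisensteinSelmerStructure` is a Howard Selmer structure for `Σ = ∞ ∪ S ∪ {v ∣ p}`, the `E`-instance of
`OrdinaryFiltration` (`Ê[p^k]`), the Selmer compatibility of the control map `𝔖 → H¹(K, T_𝔮)`
(`ZpExtensionEisensteinTwistCores`), control bounds, self-duality of `F_𝔮` (Howard H.4). BSD is not proved by any
of this.

References: [Howard2004HeegnerKolyvagin] B. Howard, *The Heegner point Kolyvagin system*, Compositio Math. 140
(2004) — arXiv 1202.6340 Def. 2.1.1 (p. 5, L28–44: local conditions, propagation), Def. 2.1.10, §3.1 (p. 15,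
L56–66: `Fil_v T_𝔮`, `H¹_ord`), Def. 3.1.2 (p. 15, L99–108), Def. 3.2.5–3.2.6 (p. 16, L84–110), Lemma 3.2.7;
[MazurRubinMemoirs2004] B. Mazur, K. Rubin, *Kolyvagin systems*, Mem. AMS 799 (2004), Def. 1.1.1, Example 1.1.2,
§5.3; [GreenbergLNM1716] R. Greenberg, LNM 1716 (1999), §2 (ordinary condition via `F⁺`);
[SerreGaloisCohomology1997] I §2.2, §2.4 (functoriality, compatible pairs), II §1.
-/

noncomputable section

open scoped TensorProduct Topology ContRepresentation
open Field Filter IsDedekindDomain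

universe u

namespace Literature.NumberTheory.EllipticCurves

open Literature.NumberTheory.GaloisRepresentations
open Literature.NumberTheory.GaloisRepresentations.DiscreteGaloisModule (SelmerStructure)
open scoped NumberField

/-! ## §1 Towers of abelian groups: compatible families, saturation, level conditions -/

namespace Tower

variable {H : ℕ → Type u} [∀ j, AddCommGroup (H j)] (red : ∀ j, H (j + 1) →+ H j)

/-- The **compatible families** `{x ∈ Π_j H_j | red_j x_{j+1} = x_j}` of a tower of abelian groups
`… → H_{j+1} → H_j → … → H_0` — the inverse limit `lim_j H_j` as a subgroup of the product (for
`H_j = H¹(K_v, T_𝔮/p^j)`: the local cohomology `H¹(K_v, T_𝔮)` of the compact module).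
[cite: SerreGaloisCohomology1997, Ch. I §2.2 and Ch. II §1 (cohomology with compact coefficients as a limit)] -/
def compatibleFamilies : AddSubgroup (Π j, H j) :=
  ⨅ j : ℕ, ((red j).comp (Pi.evalAddMonoidHom H (j + 1)) - Pi.evalAddMonoidHom H j).ker

/-- Membership in `compatibleFamilies`: `red_j x_{j+1} = x_j` for all `j`.
[cite: SerreGaloisCohomology1997, Ch. I §2.2] -/
@[simp]
theorem mem_compatibleFamilies_iff (x : Π j, H j) :
    x ∈ compatibleFamilies red ↔ ∀ j, red j (x (j + 1)) = x j := by
  simp [compatibleFamilies, AddSubgroup.mem_iInf, AddMonoidHom.mem_ker, sub_eq_zero]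

/-- **The saturated families** of a tower with respect to level-wise CORE conditions `C_j ≤ H_j` and a number
`p`: the compatible families `x` with `p^a • x_j ∈ C_j` for all `j`, for some `a` independent of `j`. For
`H_j = H¹(K_v, T/p^j T)` (`T` a compact `ℤ_p`-module of coefficients) and `C_j = ker r_j` for a test map `r`
functorial in the coefficients, this is Howard's local condition on `T` PROPAGATED FROM `V = T ⊗ ℚ_p` (the
preimage of `ker (H¹(K_v, V) → H¹(·, V-coefficients))`): `r x` maps to zero with `ℚ_p`-coefficients iff it is
`p`-power torsion. [cite: Howard2004HeegnerKolyvagin, Def. 2.1.1 (arXiv Def. 2.1.1: propagation = preimage for a submodule) and Def. 3.1.2 (F_𝔮 on T_𝔮 propagated from V_𝔮)]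
[cite: MazurRubinMemoirs2004, Def. 1.1.1 and Example 1.1.2] -/
def saturatedFamilies (p : ℕ) (C : ∀ j, AddSubgroup (H j)) : AddSubgroup (Π j, H j) where
  carrier := {x | x ∈ compatibleFamilies red ∧ ∃ a : ℕ, ∀ j, p ^ a • x j ∈ C j}
  zero_mem' := ⟨zero_mem _, 0, fun j ↦ by simp⟩
  add_mem' := by
    rintro x y ⟨hx, a, ha⟩ ⟨hy, b, hb⟩
    refine ⟨add_mem hx hy, a + b, fun j ↦ ?_⟩
    rw [Pi.add_apply, smul_add]
    refine add_mem ?_ ?_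
    · rw [pow_add, mul_comm, mul_smul]
      exact AddSubgroup.nsmul_mem _ (ha j) _
    · rw [pow_add, mul_smul]
      exact AddSubgroup.nsmul_mem _ (hb j) _
  neg_mem' := by
    rintro x ⟨hx, a, ha⟩
    exact ⟨neg_mem hx, a, fun j ↦ by simpa using neg_mem (ha j)⟩

/-- Membership in `saturatedFamilies`. [cite: Howard2004HeegnerKolyvagin, Def. 2.1.1 and Def. 3.1.2] -/
@[simp]
theorem mem_saturatedFamilies_iff (p : ℕ) (C : ∀ j, AddSubgroup (H j)) (x : Π j, H j) :
    x ∈ saturatedFamilies red p C ↔ (∀ j, red j (x (j + 1)) = x j) ∧ ∃ a : ℕ, ∀ j, p ^ a • x j ∈ C j := by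
  change (x ∈ compatibleFamilies red ∧ _) ↔ _
  rw [mem_compatibleFamilies_iff]

/-- Saturated families are compatible families. [cite: Howard2004HeegnerKolyvagin, Def. 2.1.1] -/
theorem saturatedFamilies_le_compatibleFamilies (p : ℕ) (C : ∀ j, AddSubgroup (H j)) :
    saturatedFamilies red p C ≤ compatibleFamilies red := fun _ hx ↦ hx.1

/-- **The level-`k` condition** `{x_k | x a saturated family} ≤ H_k`: Howard's local condition on the compact
module (propagated from `V`) PROPAGATED TO THE QUOTIENT `T/p^k T` (= image under `H¹(K_v, T) → H¹(K_v, T/p^k T)`,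
i.e. under `x ↦ x_k`). [cite: Howard2004HeegnerKolyvagin, Def. 2.1.1 (arXiv Def. 2.1.1: propagation = image for a quotient) and Def. 2.1.3 (Quot(T))]
[cite: MazurRubinMemoirs2004, Example 1.1.2] -/
def levelCondition (p : ℕ) (C : ∀ j, AddSubgroup (H j)) (k : ℕ) : AddSubgroup (H k) :=
  (saturatedFamilies red p C).map (Pi.evalAddMonoidHom H k)

/-- Membership in the level condition: `y = x_k` for a saturated family `x`.
[cite: Howard2004HeegnerKolyvagin, Def. 2.1.1] -/
theorem mem_levelCondition_iff (p : ℕ) (C : ∀ j, AddSubgroup (H j)) (k : ℕ) (y : H k) :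
    y ∈ levelCondition red p C k ↔ ∃ x ∈ saturatedFamilies red p C, x k = y := by
  simp [levelCondition, AddSubgroup.mem_map]

/-- The `k`-th component of a saturated family lies in the level-`k` condition.
[cite: Howard2004HeegnerKolyvagin, Def. 2.1.1] -/
theorem apply_mem_levelCondition (p : ℕ) (C : ∀ j, AddSubgroup (H j)) {x : Π j, H j}
    (hx : x ∈ saturatedFamilies red p C) (k : ℕ) : x k ∈ levelCondition red p C k :=
  (mem_levelCondition_iff red p C k (x k)).2 ⟨x, hx, rfl⟩

/-- **A compatible family lying in the cores at every level lies in the level condition at every level**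
(`a = 0`) — the form in which the images of Selmer classes under the control map are shown to satisfy `F_𝔮`.
[cite: Howard2004HeegnerKolyvagin, Def. 2.1.1 and Lemma 3.2.7] -/
theorem mem_levelCondition_of_forall_mem (p : ℕ) (C : ∀ j, AddSubgroup (H j)) {x : Π j, H j}
    (hx : ∀ j, red j (x (j + 1)) = x j) (hC : ∀ j, x j ∈ C j) (k : ℕ) : x k ∈ levelCondition red p C k :=
  apply_mem_levelCondition red p C ((mem_saturatedFamilies_iff red p C x).2
    ⟨hx, 0, fun j ↦ by simpa using hC j⟩) k

/-- Saturation is monotone in the cores. [cite: Howard2004HeegnerKolyvagin, Def. 2.1.1 and Def. 2.1.10 (the partial order F ≤ F')] -/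
theorem saturatedFamilies_mono (p : ℕ) {C C' : ∀ j, AddSubgroup (H j)} (h : ∀ j, C j ≤ C' j) :
    saturatedFamilies red p C ≤ saturatedFamilies red p C' := by
  rintro x ⟨hx, a, ha⟩
  exact ⟨hx, a, fun j ↦ h j (ha j)⟩

/-- The level conditions are monotone in the cores. [cite: Howard2004HeegnerKolyvagin, Def. 2.1.10 (F ≤ F')] -/
theorem levelCondition_mono (p : ℕ) {C C' : ∀ j, AddSubgroup (H j)} (h : ∀ j, C j ≤ C' j) (k : ℕ) :
    levelCondition red p C k ≤ levelCondition red p C' k :=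
  AddSubgroup.map_mono (saturatedFamilies_mono red p h)

/-- With every core the whole group, the level condition is the group of `k`-th components of compatible
families (the image of `H¹(K_v, T) → H¹(K_v, T/p^k T)`; in general a proper subgroup).
[cite: Howard2004HeegnerKolyvagin, Def. 2.1.1 (relaxed condition, propagation to a quotient)] -/
theorem mem_levelCondition_top_iff (p : ℕ) (k : ℕ) (y : H k) :
    y ∈ levelCondition red p (fun _ ↦ ⊤) k ↔ ∃ x ∈ compatibleFamilies red, x k = y := by
  rw [mem_levelCondition_iff]
  constructor
  · rintro ⟨x, hx, rfl⟩
    exact ⟨x, hx.1, rfl⟩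
  · rintro ⟨x, hx, rfl⟩
    exact ⟨x, ⟨hx, 0, fun j ↦ AddSubgroup.mem_top _⟩, rfl⟩

end Tower

/-! ## §2 Restricting equivariant maps to a place; the local towers `H¹(K_v, W_{k+1}) → H¹(K_v, W_k)` -/

namespace DiscreteGaloisModule

variable {K : Type u} [Field K] {M N : Type u} [AddCommGroup M] [TopologicalSpace M] [DiscreteTopology M]
  [AddCommGroup N] [TopologicalSpace N] [DiscreteTopology N]
  {ρ : DiscreteGaloisModule K M} {ρ' : DiscreteGaloisModule K N}

/-- An equivariant continuous map `f : M → N` of discrete `Γ_K`-modules is equivariant for the actions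
restricted along any continuous homomorphism `φ : Γ_L → Γ_K` (same underlying map; "compatible pair"
`(φ, f)`). [cite: SerreGaloisCohomology1997, Ch. I §2.4 (compatible pairs)] -/
def restrictMap {L : Type u} [Field L] (f : ρ.toContRepresentation →ⁱL ρ'.toContRepresentation)
    (φ : absoluteGaloisGroup L →ₜ* absoluteGaloisGroup K) :
    (ContinuousRep.restrict ρ φ).toContRepresentation →ⁱL (ContinuousRep.restrict ρ' φ).toContRepresentation where
  toContinuousLinearMap := f.toContinuousLinearMap
  isIntertwining' σ := f.isIntertwining' (φ σ)

/-- Unfolding `restrictMap`: the same function. [cite: SerreGaloisCohomology1997, Ch. I §2.4] -/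
@[simp]
theorem restrictMap_apply {L : Type u} [Field L] (f : ρ.toContRepresentation →ⁱL ρ'.toContRepresentation)
    (φ : absoluteGaloisGroup L →ₜ* absoluteGaloisGroup K) (x : M) : restrictMap f φ x = f x :=
  rfl

/-- **Pull-back commutes with change of module** (degree `1`): `φ^* (H¹(f) x) = H¹(f|_φ) (φ^* x)` — both are the
class of `f ∘ c ∘ φ`. [cite: SerreGaloisCohomology1997, Ch. I §2.4 (compatible pairs)] -/
theorem pullback_map_one {L : Type u} [Field L] (f : ρ.toContRepresentation →ⁱL ρ'.toContRepresentation)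
    (φ : absoluteGaloisGroup L →ₜ* absoluteGaloisGroup K) (x : galoisCohomology ρ 1) :
    galoisCohomology.pullback ρ' φ 1 (galoisCohomology.map f 1 x) =
      galoisCohomology.map (restrictMap f φ) 1 (galoisCohomology.pullback ρ φ 1 x) := by
  obtain ⟨c, rfl⟩ := oneCocycleClass_surjective ρ.toTopRep x
  change galoisCohomology.pullback ρ' φ 1 (ContinuousCohomology.map _ _ 1 _) =
    ContinuousCohomology.map _ _ 1 (galoisCohomology.pullback ρ φ 1 _)
  rw [map_oneCocycleClass, galoisCohomology.pullback_one_oneCocycleClass,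
    galoisCohomology.pullback_one_oneCocycleClass, map_oneCocycleClass]
  exact congrArg _ (Subtype.ext (ContinuousMap.ext fun _ ↦ rfl))

variable [NumberField K]

/-- **The restriction of an equivariant map to a place `v`**: `f` as a map of the local modules
`M|_{Γ_{K_v}} → N|_{Γ_{K_v}}` (`DiscreteGaloisModule.toLocal`, restriction along `absGaloisRestrict K K_v`).
[cite: SerreGaloisCohomology1997, Ch. I §2.4 (compatible pairs) and Ch. II §6.1] -/
def localMap (f : ρ.toContRepresentation →ⁱL ρ'.toContRepresentation) (v : NumberField.Place K) :
    (ρ.toLocal v).toContRepresentation →ⁱL (ρ'.toLocal v).toContRepresentation :=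
  restrictMap f (absGaloisRestrict K (NumberField.Place.Completion v))

/-- Unfolding `localMap`: the same function. [cite: SerreGaloisCohomology1997, Ch. I §2.4] -/
@[simp]
theorem localMap_apply (f : ρ.toContRepresentation →ⁱL ρ'.toContRepresentation) (v : NumberField.Place K) (x : M) :
    localMap f v x = f x :=
  rfl

/-- **Localisation commutes with change of module** (degree `1`): `loc_v (H¹(f) x) = H¹(f_v) (loc_v x)`.
[cite: SerreGaloisCohomology1997, Ch. I §2.4 (compatible pairs) and Ch. II §6.1 (localisation)] -/
theorem localization_map_one (f : ρ.toContRepresentation →ⁱL ρ'.toContRepresentation) (v : NumberField.Place K)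
    (x : galoisCohomology ρ 1) :
    galoisCohomology.localization ρ' v 1 (galoisCohomology.map f 1 x) =
      galoisCohomology.map (localMap f v) 1 (galoisCohomology.localization ρ v 1 x) :=
  pullback_map_one f _ x

end DiscreteGaloisModule

namespace ZpExtension

variable {K : Type u} [Field K] {p : ℕ} [hp : Fact p.Prime] (κ : ZpExtension K p)
  {M : ℕ → Type u} [∀ k, AddCommGroup (M k)] [∀ k, TopologicalSpace (M k)] [∀ k, DiscreteTopology (M k)]
  (ρ : ∀ k, DiscreteGaloisModule K (M k))
  (t : ∀ k, (ρ (k + 1)).toContRepresentation →ⁱL (ρ k).toContRepresentation) {m : ℕ} (hm : 1 ≤ m)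

section LocalTower

variable [NumberField K]

/-- **The local tower at a place `v`**: the reduction `H¹(K_v, W_{k+1}) → H¹(K_v, W_k)`,
`W_k = M_k ⊗ A_{m,k}(ψ)` restricted to `Γ_{K_v}`, induced by `eisensteinTwistReduce hm _ (t k)` — the maps along
which `H¹(K_v, T_𝔮) = lim_k H¹(K_v, T_𝔮/p^k T_𝔮)`. [cite: Howard2004HeegnerKolyvagin, §2.2 and Lemma 3.2.7 (arXiv; local cohomology of T_𝔮)]
[cite: SerreGaloisCohomology1997, Ch. II §1] -/
def eisensteinLocalReduce (v : NumberField.Place K) (k : ℕ) :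
    galoisCohomology ((κ.eisensteinTwist (ρ (k + 1)) hm (k + 1)).toLocal v) 1 →+
      galoisCohomology ((κ.eisensteinTwist (ρ k) hm k).toLocal v) 1 :=
  galoisCohomology.map (DiscreteGaloisModule.localMap (κ.eisensteinTwistReduce hm (Nat.le_succ k) (t k)) v) 1

/-- **Localisation is a map of towers**: `loc_v ∘ H¹(reduce_k) = (local reduce_k) ∘ loc_v`, so the
localisation of a compatible family of global classes (an element of the pinned `H¹(K, T_𝔮)`) is a compatible
family of local classes. [cite: SerreGaloisCohomology1997, Ch. I §2.4 and Ch. II §6.1] [cite: Howard2004HeegnerKolyvagin, Lemma 3.2.7] -/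
theorem localization_map_eisensteinTwistReduce (v : NumberField.Place K) (k : ℕ)
    (x : galoisCohomology (κ.eisensteinTwist (ρ (k + 1)) hm (k + 1)) 1) :
    galoisCohomology.localization (κ.eisensteinTwist (ρ k) hm k) v 1
        (galoisCohomology.map (κ.eisensteinTwistReduce hm (Nat.le_succ k) (t k)) 1 x) =
      κ.eisensteinLocalReduce ρ t hm v k
        (galoisCohomology.localization (κ.eisensteinTwist (ρ (k + 1)) hm (k + 1)) v 1 x) :=
  DiscreteGaloisModule.localization_map_one _ v x

/-- For `h` in the pinned `H¹(K, T_𝔮)`, the local components `(loc_v (proj k h))_k` form a compatible family of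
the local tower at `v`. [cite: Howard2004HeegnerKolyvagin, §2.2 and Lemma 3.2.7] [cite: SerreGaloisCohomology1997, Ch. II §6.1] -/
theorem localization_proj_mem_compatibleFamilies (D : EisensteinH1Data κ ρ t hm) (v : NumberField.Place K)
    (h : D.H) :
    (fun k ↦ galoisCohomology.localization (κ.eisensteinTwist (ρ k) hm k) v 1 (D.proj k h)) ∈
      Tower.compatibleFamilies (κ.eisensteinLocalReduce ρ t hm v) := by
  rw [Tower.mem_compatibleFamilies_iff]
  intro k
  rw [← localization_map_eisensteinTwistReduce, D.proj_reduce]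

end LocalTower

/-! ## §3 Ordinary data at `v ∣ p`: `Fil_v M_k`, the twisted plus part `A_{m,k} ⊗ Fil_v M_k ≤ W_k`, the core -/

section Ordinary

variable [NumberField K]

/-- **An ordinary filtration of the tower `(M_k, t_k)` at a finite place `v`** (Howard Def. 3.2.5: `Fil_v T` =
the kernel of the reduction map `T_p(E) → T_p(Ẽ)` at `v ∣ p`; Greenberg's `F⁺`): a `ℤ`-submodule
`fil k ≤ M_k` for every `k`, stable under the decomposition group `Γ_{K_v}` (acting through
`GaloisRep.toLocal v (ρ k)`, i.e. through `absGaloisRestrict K K_v`) and mapped into `fil k` by the transition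
`t k : M_{k+1} → M_k`. Intended instance: `fil k = Ê[p^k] ⊆ E[p^k]` for `E` with good ordinary reduction at `v`.
[cite: Howard2004HeegnerKolyvagin, Def. 3.2.5 (arXiv; Fil_v T, Fil_v 𝐓)] [cite: GreenbergLNM1716, §2 (F⁺, ordinary condition)] -/
structure OrdinaryFiltration (v : HeightOneSpectrum (𝓞 K)) where
  /-- The plus part `Fil_v M_k ≤ M_k`. -/
  fil (k : ℕ) : Submodule ℤ (M k)
  /-- `Fil_v M_k` is stable under `Γ_{K_v}`. -/
  smul_mem : ∀ (k : ℕ) (σ : absoluteGaloisGroup (v.adicCompletion K)) (a : M k),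
    a ∈ fil k → GaloisRep.toLocal v (ρ k) σ a ∈ fil k
  /-- The transitions map `Fil_v M_{k+1}` into `Fil_v M_k`. -/
  map_mem : ∀ (k : ℕ) (a : M (k + 1)), a ∈ fil (k + 1) → t k a ∈ fil k

variable {κ ρ t} {v : HeightOneSpectrum (𝓞 K)} (Φ : OrdinaryFiltration ρ t v)

/-- **The twisted plus part `Fil_v W_k = A_{m,k} ⊗ Fil_v M_k ≤ W_k = A_{m,k} ⊗ M_k`** (Howard:
`Fil_v T_𝔮 = (Fil_v T) ⊗ S_𝔮`): the `ℤ`-span of the pure tensors `c ⊗ a`, `a ∈ Fil_v M_k`.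
[cite: Howard2004HeegnerKolyvagin, §3.1 (arXiv p. 15, L56–62: Fil_v T_𝔮 = (Fil_v T) ⊗ S_𝔮)] -/
def OrdinaryFiltration.twistedFil (k : ℕ) : Submodule ℤ (IwasawaAlgebra.EisensteinCoeff.Twisted p m k (M k)) :=
  Submodule.span ℤ {x | ∃ (c : IwasawaAlgebra.EisensteinCoeff p m k) (a : M k),
    a ∈ Φ.fil k ∧ x = IwasawaAlgebra.EisensteinCoeff.Twisted.tmul c a}

/-- Pure tensors `c ⊗ a` with `a ∈ Fil_v M_k` lie in the twisted plus part.
[cite: Howard2004HeegnerKolyvagin, §3.1 (Fil_v T_𝔮)] -/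
theorem OrdinaryFiltration.tmul_mem_twistedFil (k : ℕ) (c : IwasawaAlgebra.EisensteinCoeff p m k) {a : M k}
    (ha : a ∈ Φ.fil k) : IwasawaAlgebra.EisensteinCoeff.Twisted.tmul c a ∈ Φ.twistedFil k :=
  Submodule.subset_span ⟨c, a, ha, rfl⟩

/-- **The twisted plus part is stable under the twisted LOCAL action**: `σ ∈ Γ_{K_v}` sends `c ⊗ a` to
`((1+T)^{κ(σ)} c) ⊗ ρ(σ) a`, again a pure tensor with second factor in `Fil_v M_k` (`Φ.smul_mem`).
[cite: Howard2004HeegnerKolyvagin, §3.1 (Fil_v T_𝔮 is a G_{K_v}-submodule)] -/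
theorem OrdinaryFiltration.twistedFil_le_comap (k : ℕ) (σ : absoluteGaloisGroup (v.adicCompletion K)) :
    Φ.twistedFil k ≤ (Φ.twistedFil k).comap (GaloisRep.toLocal v (κ.eisensteinTwist (ρ k) hm k) σ) := by
  rw [OrdinaryFiltration.twistedFil, Submodule.span_le]
  rintro x ⟨c, a, ha, rfl⟩
  rw [SetLike.mem_coe, Submodule.mem_comap, GaloisRep.toLocal_apply]
  change κ.eisensteinTwist (ρ k) hm k _ (IwasawaAlgebra.EisensteinCoeff.Twisted.tmul c a) ∈ Φ.twistedFil k
  rw [κ.eisensteinTwist_apply_tmul (ρ k) hm k]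
  exact Φ.tmul_mem_twistedFil k _ (Φ.smul_mem k σ a ha)

/-- **The level-`k` core at `v ∣ p`: the STRICT ordinary condition**
`ker (H¹(K_v, W_k) → H¹(K_v, W_k / Fil_v W_k)) = im (H¹(K_v, Fil_v W_k) → H¹(K_v, W_k))`
(the tree's `DiscreteGaloisModule.strictSubgroup` of the local module `W_k|_{Γ_{K_v}}` and its stable submodule
`Fil_v W_k`); Howard's `H¹_ord` is this with `V_𝔮`-coefficients, and `F_𝔮` at `v ∣ p` is the saturation of the
tower of these cores (§4). [cite: Howard2004HeegnerKolyvagin, §3.1 (arXiv p. 15, L62–66: H¹_ord = im H¹(K_v, Fil_v V_𝔮)) and Def. 3.2.6 (im H¹(K_v, Fil_v 𝐓))]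
[cite: GreenbergLNM1716, §2] -/
def OrdinaryFiltration.ordinaryCore (k : ℕ) :
    AddSubgroup (galoisCohomology ((κ.eisensteinTwist (ρ k) hm k).toLocal (Sum.inr v)) 1) :=
  DiscreteGaloisModule.strictSubgroup (GaloisRep.toLocal v (κ.eisensteinTwist (ρ k) hm k)) (Φ.twistedFil k)
    (Φ.twistedFil_le_comap hm k)

/-- Membership in the ordinary core: the class dies in `H¹(K_v, W_k / Fil_v W_k)`.
[cite: Howard2004HeegnerKolyvagin, §3.1 (H¹_ord)] -/
theorem OrdinaryFiltration.mem_ordinaryCore_iff (k : ℕ)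
    (c : galoisCohomology ((κ.eisensteinTwist (ρ k) hm k).toLocal (Sum.inr v)) 1) :
    c ∈ Φ.ordinaryCore hm k ↔
      DiscreteGaloisModule.quotientMap (GaloisRep.toLocal v (κ.eisensteinTwist (ρ k) hm k)) (Φ.twistedFil k)
        (Φ.twistedFil_le_comap hm k) 1 c = 0 :=
  Iff.rfl

end Ordinary

/-! ## §4 Howard's Selmer structure `F_𝔮` at level `k` -/

section SelmerStructure

variable [NumberField K]

open scoped Classical in
/-- **Howard's Selmer structure `F_𝔮` on `T_𝔮/p^k T_𝔮 = W_k`** (Def. 3.1.2 propagated to `T_𝔮` and then to the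
quotient, Def. 2.1.1), for a finite set `S` of finite places (the bad places away from `p`) and ordinary data
`Φ v` at the places `v ∣ p`:
* at an infinite place: no condition (`⊤`; for `K` imaginary quadratic `H¹(ℂ, ·) = 0` anyway);
* at `v ∣ p`: the level-`k` condition of the saturated tower of STRICT ORDINARY cores (`ordinaryCore`) — the
  propagation of `H¹_ord(K_v, V_𝔮) = im H¹(K_v, Fil_v V_𝔮)`;
* at `v ∈ S`, `v ∤ p`: the level-`k` condition of the saturated tower of UNRAMIFIED cores — the propagation of
  `H¹_unr(K_v, V_𝔮)`;
* at every other finite place: the unramified condition `H¹_ur(K_v, W_k)` (equal to the previous recipe when the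
  tower is unramified at `v`; taken as the definition so that `F_𝔮` is unramified outside `∞ ∪ S ∪ {v ∣ p}` on
  the nose, Def. 2.1.10).
[cite: Howard2004HeegnerKolyvagin, Def. 3.1.2 (arXiv p. 15, L99–108) with Def. 2.1.1 (propagation) and Def. 2.1.10 (Σ(F), H¹_f outside)]
[cite: MazurRubinMemoirs2004, Def. 1.1.1, Example 1.1.2 and §5.3] -/
def eisensteinSelmerStructure (S : Finset (HeightOneSpectrum (𝓞 K)))
    (Φ : ∀ v : HeightOneSpectrum (𝓞 K), ((p : ℕ) : 𝓞 K) ∈ v.asIdeal → OrdinaryFiltration ρ t v) (k : ℕ) :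
    SelmerStructure (κ.eisensteinTwist (ρ k) hm k) := fun v ↦
  match v with
  | Sum.inl _ => ⊤
  | Sum.inr v =>
    if hv : ((p : ℕ) : 𝓞 K) ∈ v.asIdeal then
      Tower.levelCondition (κ.eisensteinLocalReduce ρ t hm (Sum.inr v)) p
        (fun j ↦ (Φ v hv).ordinaryCore hm j) k
    else if v ∈ S then
      Tower.levelCondition (κ.eisensteinLocalReduce ρ t hm (Sum.inr v)) p
        (fun j ↦ DiscreteGaloisModule.unramifiedSubgroup (GaloisRep.toLocal v (κ.eisensteinTwist (ρ j) hm j)) 1) k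
    else DiscreteGaloisModule.unramifiedSubgroup (GaloisRep.toLocal v (κ.eisensteinTwist (ρ k) hm k)) 1

variable (S : Finset (HeightOneSpectrum (𝓞 K)))
  (Φ : ∀ v : HeightOneSpectrum (𝓞 K), ((p : ℕ) : 𝓞 K) ∈ v.asIdeal → OrdinaryFiltration ρ t v) (k : ℕ)

/-- `F_𝔮` at an infinite place: no condition. [cite: Howard2004HeegnerKolyvagin, Def. 2.1.10 (archimedean places in Σ(F))] -/
@[simp]
theorem eisensteinSelmerStructure_inl (w : NumberField.InfinitePlace K) :
    κ.eisensteinSelmerStructure ρ t hm S Φ k (Sum.inl w) = ⊤ :=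
  rfl

/-- `F_𝔮` at `v ∣ p`: the level condition of the saturated strict-ordinary tower.
[cite: Howard2004HeegnerKolyvagin, Def. 3.1.2 (H¹_ord at v ∣ p, propagated to T_𝔮)] -/
theorem eisensteinSelmerStructure_inr_of_mem {v : HeightOneSpectrum (𝓞 K)} (hv : ((p : ℕ) : 𝓞 K) ∈ v.asIdeal) :
    κ.eisensteinSelmerStructure ρ t hm S Φ k (Sum.inr v) =
      Tower.levelCondition (κ.eisensteinLocalReduce ρ t hm (Sum.inr v)) p
        (fun j ↦ (Φ v hv).ordinaryCore hm j) k := by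
  simp only [eisensteinSelmerStructure, dif_pos hv]

/-- `F_𝔮` at a place of `S` away from `p`: the level condition of the saturated unramified tower.
[cite: Howard2004HeegnerKolyvagin, Def. 3.1.2 (H¹_unr else, propagated to T_𝔮)] -/
theorem eisensteinSelmerStructure_inr_of_mem_of_not_mem {v : HeightOneSpectrum (𝓞 K)}
    (hv : ((p : ℕ) : 𝓞 K) ∉ v.asIdeal) (hvS : v ∈ S) :
    κ.eisensteinSelmerStructure ρ t hm S Φ k (Sum.inr v) =
      Tower.levelCondition (κ.eisensteinLocalReduce ρ t hm (Sum.inr v)) p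
        (fun j ↦ DiscreteGaloisModule.unramifiedSubgroup (GaloisRep.toLocal v (κ.eisensteinTwist (ρ j) hm j)) 1)
        k := by
  classical
  simp only [eisensteinSelmerStructure, dif_neg hv, if_pos hvS]

/-- `F_𝔮` at a finite place outside `S ∪ {v ∣ p}`: the unramified condition.
[cite: Howard2004HeegnerKolyvagin, Def. 2.1.10 (H¹_F = H¹_f = H¹_unr outside Σ(F))] -/
theorem eisensteinSelmerStructure_inr_of_not_mem {v : HeightOneSpectrum (𝓞 K)}
    (hv : ((p : ℕ) : 𝓞 K) ∉ v.asIdeal) (hvS : v ∉ S) :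
    κ.eisensteinSelmerStructure ρ t hm S Φ k (Sum.inr v) =
      DiscreteGaloisModule.unramifiedSubgroup (GaloisRep.toLocal v (κ.eisensteinTwist (ρ k) hm k)) 1 := by
  classical
  simp only [eisensteinSelmerStructure, dif_neg hv, if_neg hvS]

end SelmerStructure

/-! ## §5 The pinned Selmer module `H¹_{F_𝔮}(K, T_𝔮) ≤ H¹(K, T_𝔮)` -/

namespace EisensteinH1Data

variable {κ ρ t hm} [NumberField K] (D : EisensteinH1Data κ ρ t hm)
  (S : Finset (HeightOneSpectrum (𝓞 K)))
  (Φ : ∀ v : HeightOneSpectrum (𝓞 K), ((p : ℕ) : 𝓞 K) ∈ v.asIdeal → OrdinaryFiltration ρ t v)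

/-- **Howard's `H¹_{F_𝔮}(K, T_𝔮) = lim_k H¹_{F_𝔮}(K, T_𝔮/p^k T_𝔮)` inside the pinned `H¹(K, T_𝔮)`**: the elements
all of whose projections are `F_𝔮`-Selmer classes (`selmerAddSubgroup` of the family
`eisensteinSelmerStructure … k`). For the intended `E`-instance and `κ` replaced by `κ.unitTwist (-1)` this is
the `S_𝔮`-module `H¹_{F_𝔮}(K, T_𝔮)` of Howard's Prop. 3.1.3 / Lemma 3.2.7 / Prop. 3.2.8, the target of the
control map from `𝔖 = H¹_{F_Λ}(K, 𝐓)`. (That it is a `Λ`-submodule follows from the stability of `F_𝔮` under the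
coefficient action, proved in the companion file.) [cite: Howard2004HeegnerKolyvagin, Def. 3.1.2, Prop. 3.1.3 and Prop. 3.2.8 (arXiv; H¹_{F_𝔮}(K, T_𝔮))]
[cite: MazurRubinMemoirs2004, §5.3] -/
def ordinarySelmer : AddSubgroup D.H :=
  D.selmerAddSubgroup (κ.eisensteinSelmerStructure ρ t hm S Φ)

/-- Membership in `ordinarySelmer`: every projection is an `F_𝔮`-Selmer class.
[cite: Howard2004HeegnerKolyvagin, Def. 3.1.2 and Def. 2.1.10] -/
theorem mem_ordinarySelmer_iff (h : D.H) :
    h ∈ D.ordinarySelmer S Φ ↔ ∀ k, D.proj k h ∈ (κ.eisensteinSelmerStructure ρ t hm S Φ k).selmerGroup :=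
  D.mem_selmerAddSubgroup_iff _ h

/-- Membership in `ordinarySelmer`, place by place: for every `k` and every place `v` the localisation of the
`k`-th projection lies in `F_𝔮(v)`. [cite: Howard2004HeegnerKolyvagin, Def. 2.1.10 («classes whose localization lives in H¹_F(K_v,T) at every place v»)] -/
theorem mem_ordinarySelmer_iff_forall (h : D.H) :
    h ∈ D.ordinarySelmer S Φ ↔ ∀ (k : ℕ) (v : NumberField.Place K),
      galoisCohomology.localization (κ.eisensteinTwist (ρ k) hm k) v 1 (D.proj k h) ∈
        κ.eisensteinSelmerStructure ρ t hm S Φ k v := by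
  simp only [mem_ordinarySelmer_iff, DiscreteGaloisModule.SelmerStructure.mem_selmerGroup_iff]

end EisensteinH1Data

end ZpExtension

end Literature.NumberTheory.EllipticCurves

end
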